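import Mathlib
import Summits.ValiantsHypothesis.ValiantsHypothesis.Theorems.ValuativeGCTHeadFlipRankBoundDefs

/-!
# Generating-function identities for the mixed elementary symmetric polynomials `rbE`
(crux `ValuativeGCT.HeadFlip`, stmt-ValiantsHypothesis-15535, line `four-row-count`,
registered stubs `stub_rbE1`, `stub_rbE2`; file "RB1: ESymm" of the rank certificate)

For the explicit pencil of `Theorems/ValuativeGCTHeadFlipRankBoundDefs.lean`
(`a_k = k + 1`, `d_k = a_k·y₀ + y₃`, `u_k = a_k²·y₁ + a_k³·y₂`) and the mixed elementary
symmetric polynomials `e_s(T) = Σ_{S ⊆ T, |S| = s} u^S d^{T∖S}` (`rbE s T`, the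
`x^s`-coefficient of `Π_{k ∈ T} (d_k + x·u_k)`) we prove:
* (E1) `Σ_s (-1)^s e_s(T) = Π_{k ∈ T} (d_k - u_k)` (`stub_rbE1`, the value at `x = -1`;
  `Finset.prod_sub` regrouped by cardinality);
* the double count `Σ_{b ∈ T} u_b·e_s(T ∖ b) = (s+1)·e_{s+1}(T)` (`sum_rbU_mul_rbE_erase`)
  and from it (E2) `Σ_s (-1)^{s+1} s·e_s(T) = Σ_{b ∈ T} u_b Π_{k ∈ T ∖ b} (d_k - u_k)`
  (`stub_rbE2`, the derivative at `x = -1`);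
* (E3) the recursion `e_{s+1}(T ∪ k) = d_k·e_{s+1}(T) + u_k·e_s(T)` for `k ∉ T`
  (`rbE_insert`);
* weighted homogeneity for the weight `![0, 1, 1, 0]` (= degree in `y₁, y₂`): `d_k`, `u_k`,
  `e_s(T)` have weights `0`, `1`, `s`;
* the closed-form minors `rbPer` regrouped by cardinality:
  `Per_ii = Σ_{s < n} s!·e_s([n] ∖ i)`, `Per_ij = u_j·Σ_{s < n} (s+1)!·e_s([n] ∖ {i, j})`
  (`rbPer_diag`, `rbPer_offdiag`).
[this crux; elementary algebra, new]
-/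

-- `Summit.ValiantsHypothesis.ValiantsHypothesis.…` is the tree's mandated single-conjunct layout (Sub = Summit).
set_option linter.dupNamespace false

namespace Summit.ValiantsHypothesis.ValiantsHypothesis.Theorems.HeadFlip

open MvPolynomial Finset
open scoped BigOperators

noncomputable section

/-! ### The linear forms `d_k`, `u_k` and their weights -/

/-- `d_k = y₃ + a_k·y₀` explicitly. [this crux] -/
theorem rbD_eq {n : ℕ} (k : Fin n) :
    rbD k = (X 3 : MvPolynomial (Fin 4) ℂ) + C (rbA k) * X 0 := by
  simp [rbD, rbDv, Fin.sum_univ_four, smul_eq_C_mul, add_comm]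

/-- `u_k = a_k²·y₁ + a_k³·y₂` explicitly. [this crux] -/
theorem rbU_eq {n : ℕ} (k : Fin n) :
    rbU k = C (rbA k ^ 2) * (X 1 : MvPolynomial (Fin 4) ℂ) + C (rbA k ^ 3) * X 2 := by
  simp [rbU, rbUv, Fin.sum_univ_four, smul_eq_C_mul]

/-- `d_k` is weighted-homogeneous of weight `0` for the weight `![0, 1, 1, 0]` (it does not involve
`y₁, y₂`). [this crux] -/
theorem rbD_isWeightedHomogeneous {n : ℕ} (k : Fin n) :
    IsWeightedHomogeneous (![0, 1, 1, 0] : Fin 4 → ℕ) (rbD k) 0 := by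
  rw [rbD_eq]
  exact (isWeightedHomogeneous_X ℂ (![0, 1, 1, 0] : Fin 4 → ℕ) 3).add
    ((isWeightedHomogeneous_X ℂ (![0, 1, 1, 0] : Fin 4 → ℕ) 0).C_mul _)

/-- `u_k` is weighted-homogeneous of weight `1` for the weight `![0, 1, 1, 0]` (it is linear in
`y₁, y₂`). [this crux] -/
theorem rbU_isWeightedHomogeneous {n : ℕ} (k : Fin n) :
    IsWeightedHomogeneous (![0, 1, 1, 0] : Fin 4 → ℕ) (rbU k) 1 := by
  rw [rbU_eq]
  exact ((isWeightedHomogeneous_X ℂ (![0, 1, 1, 0] : Fin 4 → ℕ) 1).C_mul _).add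
    ((isWeightedHomogeneous_X ℂ (![0, 1, 1, 0] : Fin 4 → ℕ) 2).C_mul _)

/-! ### The mixed elementary symmetric polynomials `e_s(T)` -/

/-- `e_s(T) = 0` for `s > |T|` (there are no `s`-subsets). [this crux] -/
theorem rbE_eq_zero_of_card_lt {n : ℕ} {s : ℕ} {T : Finset (Fin n)} (h : T.card < s) :
    rbE s T = 0 := by
  rw [rbE, Finset.powersetCard_eq_empty.2 h, sum_empty]

/-- `e_0(T) = Π_{k ∈ T} d_k`. [this crux] -/
theorem rbE_zero {n : ℕ} (T : Finset (Fin n)) : rbE 0 T = ∏ k ∈ T, rbD k := by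
  rw [rbE, powersetCard_zero, sum_singleton, prod_empty, one_mul, sdiff_empty]

/-- `e_{|T|}(T) = Π_{k ∈ T} u_k`. [this crux] -/
theorem rbE_card_self {n : ℕ} (T : Finset (Fin n)) : rbE T.card T = ∏ k ∈ T, rbU k := by
  rw [rbE, powersetCard_self, sum_singleton, Finset.sdiff_self, prod_empty, mul_one]

/-- (E3), bottom case: `e_0(T ∪ k) = d_k·e_0(T)` for `k ∉ T`. [this crux] -/
theorem rbE_zero_insert {n : ℕ} {k : Fin n} {T : Finset (Fin n)} (hk : k ∉ T) :
    rbE 0 (insert k T) = rbD k * rbE 0 T := by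
  rw [rbE_zero, rbE_zero, prod_insert hk]

/-- (E3), the recursion `e_{s+1}(T ∪ k) = d_k·e_{s+1}(T) + u_k·e_s(T)` for `k ∉ T`: split the
`(s+1)`-subsets of `T ∪ k` according to whether they contain `k`. [this crux] -/
theorem rbE_insert {n : ℕ} {k : Fin n} {T : Finset (Fin n)} (hk : k ∉ T) (s : ℕ) :
    rbE (s + 1) (insert k T) = rbD k * rbE (s + 1) T + rbU k * rbE s T := by
  have hkS : ∀ {m : ℕ}, ∀ S ∈ T.powersetCard m, k ∉ S := fun S hS h =>
    hk ((mem_powersetCard.1 hS).1 h)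
  rw [rbE, powersetCard_succ_insert hk, sum_union, sum_image]
  · rw [rbE, rbE, mul_sum, mul_sum]
    congr 1
    · refine sum_congr rfl fun S hS => ?_
      rw [insert_sdiff_of_notMem T (hkS S hS), prod_insert (fun h => hk (mem_sdiff.1 h).1),
        mul_left_comm]
    · refine sum_congr rfl fun S hS => ?_
      rw [prod_insert (hkS S hS), insert_sdiff_insert, sdiff_insert_of_notMem hk, mul_assoc]
  · intro S hS S' hS' h
    rw [← erase_insert (hkS S hS), h, erase_insert (hkS S' hS')]
  · refine disjoint_left.2 fun S hS hS' => ?_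
    obtain ⟨S', hS'T, rfl⟩ := mem_image.1 hS'
    exact hkS _ hS (mem_insert_self k S')

/-- `e_s(T)` is weighted-homogeneous of weight `s` for the weight `![0, 1, 1, 0]`: every summand
`u^S d^{T∖S}` is a product of `|S| = s` weight-one forms and weight-zero forms. [this crux] -/
theorem rbE_isWeightedHomogeneous : ∀ {n : ℕ} (s : ℕ) (T : Finset (Fin n)),
    MvPolynomial.IsWeightedHomogeneous (![0, 1, 1, 0] : Fin 4 → ℕ) (rbE s T) s := by
  intro n s T
  unfold rbE
  refine IsWeightedHomogeneous.sum _ _ _ fun S hS => ?_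
  have h := (IsWeightedHomogeneous.prod S (fun k => rbU k) (fun _ => 1)
      fun k _ => rbU_isWeightedHomogeneous k).mul
    (IsWeightedHomogeneous.prod (T \ S) (fun k => rbD k) (fun _ => 0)
      fun k _ => rbD_isWeightedHomogeneous k)
  simpa [(mem_powersetCard.1 hS).2] using h

/-! ### Regrouping powerset sums by cardinality; the closed-form minors -/

/-- Regrouping a sum over all subsets of `T` by their cardinality `s`, over any range
`s < N` with `|T| < N` (the missing cardinalities contribute empty sums). [folklore] -/
theorem sum_powerset_eq_sum_range_powersetCard {α M : Type*} [AddCommMonoid M]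
    (T : Finset α) (f : Finset α → M) {N : ℕ} (hN : T.card < N) :
    ∑ S ∈ T.powerset, f S = ∑ s ∈ Finset.range N, ∑ S ∈ T.powersetCard s, f S := by
  rw [← sum_fiberwise_of_maps_to (s := T.powerset) (t := range N) (g := Finset.card)
    (fun S hS => mem_range.2 ((card_le_card (mem_powerset.1 hS)).trans_lt hN)) f]
  refine sum_congr rfl fun s _ => ?_
  rw [powersetCard_eq_filter]

/-- The diagonal closed-form minor regrouped by cardinality:
`Per_ii = Σ_{s < n} s!·e_s([n] ∖ i)`. [this crux] -/
theorem rbPer_diag : ∀ {n : ℕ} (i : Fin n),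
    rbPer i i = ∑ s ∈ Finset.range n, ((s.factorial : ℕ) : MvPolynomial (Fin 4) ℂ) * rbE s (Finset.univ.erase i) := by
  intro n i
  rw [rbPer, if_pos rfl, sum_powerset_eq_sum_range_powersetCard _ _ (N := n) ?_]
  · refine sum_congr rfl fun s _ => ?_
    rw [rbE, mul_sum]
    refine sum_congr rfl fun S hS => ?_
    rw [(mem_powersetCard.1 hS).2, mul_assoc]
  · rw [card_erase_of_mem (mem_univ i), card_univ, Fintype.card_fin]
    exact Nat.sub_lt (Fin.pos i) Nat.one_pos

/-- The off-diagonal closed-form minor regrouped by cardinality: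
`Per_ij = u_j·Σ_{s < n} (s+1)!·e_s([n] ∖ {i, j})` for `i ≠ j`. [this crux] -/
theorem rbPer_offdiag : ∀ {n : ℕ} (i j : Fin n), i ≠ j →
    rbPer i j = rbU j * ∑ s ∈ Finset.range n, (((s + 1).factorial : ℕ) : MvPolynomial (Fin 4) ℂ) * rbE s ((Finset.univ.erase i).erase j) := by
  intro n i j hij
  rw [rbPer, if_neg hij, sum_powerset_eq_sum_range_powersetCard _ _ (N := n) ?_]
  · congr 1
    refine sum_congr rfl fun s _ => ?_
    rw [rbE, mul_sum]
    refine sum_congr rfl fun S hS => ?_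
    rw [(mem_powersetCard.1 hS).2, mul_assoc]
  · have hn := Fin.pos i
    rw [card_erase_of_mem (mem_erase.2 ⟨hij.symm, mem_univ j⟩), card_erase_of_mem (mem_univ i),
      card_univ, Fintype.card_fin]
    omega

/-! ### (E1) and (E2) -/

/-- **stub_rbE1** (E1, registered sub-goal of `stub_rankBound`, line four-row-count of crux
HeadFlip): `Σ_{s ≤ |T|} (-1)^s e_s(T) = Π_{k ∈ T} (d_k - u_k)` — the value at `x = -1` of
`Π_{k ∈ T} (d_k + x·u_k) = Σ_s x^s e_s(T)` (`Finset.prod_sub` regrouped by cardinality).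
[this crux] -/
theorem stub_rbE1 : ∀ {n : ℕ} (T : Finset (Fin n)),
    ∑ s ∈ Finset.range (T.card + 1), (-1 : MvPolynomial (Fin 4) ℂ) ^ s * rbE s T = ∏ k ∈ T, (rbD k - rbU k) := by
  intro n T
  rw [prod_sub, sum_powerset_eq_sum_range_powersetCard T _ (Nat.lt_succ_self _)]
  refine sum_congr rfl fun s _ => ?_
  rw [rbE, mul_sum]
  refine sum_congr rfl fun S hS => ?_
  rw [(mem_powersetCard.1 hS).2]
  ring

/-- Double count of the pairs `b ∈ S ⊆ T`, `|S| = s + 1`: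
`Σ_{b ∈ T} u_b·e_s(T ∖ b) = (s+1)·e_{s+1}(T)`. [this crux] -/
theorem sum_rbU_mul_rbE_erase {n : ℕ} (s : ℕ) (T : Finset (Fin n)) :
    ∑ b ∈ T, rbU b * rbE s (T.erase b) =
      ((s + 1 : ℕ) : MvPolynomial (Fin 4) ℂ) * rbE (s + 1) T := by
  have hnot : ∀ b, ∀ S' ∈ (T.erase b).powersetCard s, b ∉ S' := fun b S' hS' h =>
    (notMem_erase b T) ((mem_powersetCard.1 hS').1 h)
  -- for each `b`, reindex the inner sum by `S' ↦ insert b S'`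
  have h1 : ∀ b ∈ T, rbU b * rbE s (T.erase b) =
      ∑ S ∈ (T.powersetCard (s + 1)).filter (fun S => b ∈ S),
        (∏ k ∈ S, rbU k) * ∏ k ∈ T \ S, rbD k := by
    intro b hb
    rw [rbE, mul_sum]
    refine sum_nbij' (insert b) (fun S => S.erase b) ?_ ?_ ?_ ?_ ?_
    · intro S' hS'
      obtain ⟨hsub, hcard⟩ := mem_powersetCard.1 hS'
      refine mem_filter.2 ⟨mem_powersetCard.2 ⟨?_, ?_⟩, mem_insert_self _ _⟩
      · exact insert_subset hb (hsub.trans (erase_subset _ _))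
      · rw [card_insert_of_notMem (hnot b S' hS'), hcard]
    · intro S hS
      obtain ⟨hS1, hbS⟩ := mem_filter.1 hS
      obtain ⟨hsub, hcard⟩ := mem_powersetCard.1 hS1
      refine mem_powersetCard.2 ⟨erase_subset_erase _ hsub, ?_⟩
      rw [card_erase_of_mem hbS, hcard, Nat.add_sub_cancel]
    · exact fun S' hS' => erase_insert (hnot b S' hS')
    · exact fun S hS => insert_erase (mem_filter.1 hS).2
    · intro S' hS'
      rw [prod_insert (hnot b S' hS'), sdiff_insert, ← erase_sdiff_comm, mul_assoc]
  rw [sum_congr rfl h1, sum_comm' (t' := T.powersetCard (s + 1)) (s' := fun S => S), rbE, mul_sum]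
  · refine sum_congr rfl fun S hS => ?_
    rw [sum_const, (mem_powersetCard.1 hS).2, nsmul_eq_mul]
  · intro b S
    simp only [mem_filter, mem_powersetCard]
    constructor
    · rintro ⟨-, hS, hbS⟩
      exact ⟨hbS, hS⟩
    · rintro ⟨hbS, hS⟩
      exact ⟨hS.1 hbS, hS, hbS⟩

/-- **stub_rbE2** (E2, registered sub-goal of `stub_rankBound`, line four-row-count of crux
HeadFlip): `Σ_{s ≤ |T|} (-1)^{s+1} s·e_s(T) = Σ_{b ∈ T} u_b·Π_{k ∈ T ∖ b} (d_k - u_k)`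
— the derivative at `x = -1` of `Π_{k ∈ T} (d_k + x·u_k)`; from (E1) on each `T ∖ b` and the
double count `sum_rbU_mul_rbE_erase`. [this crux] -/
theorem stub_rbE2 : ∀ {n : ℕ} (T : Finset (Fin n)),
    ∑ s ∈ Finset.range (T.card + 1), (-1 : MvPolynomial (Fin 4) ℂ) ^ (s + 1) * ((s : MvPolynomial (Fin 4) ℂ) * rbE s T) =
      ∑ b ∈ T, rbU b * ∏ k ∈ T.erase b, (rbD k - rbU k) := by
  intro n T
  -- the right-hand side: (E1) on each `T ∖ b`, then swap the two sums
  have hR : ∑ b ∈ T, rbU b * ∏ k ∈ T.erase b, (rbD k - rbU k) =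
      ∑ s ∈ range T.card,
        (-1 : MvPolynomial (Fin 4) ℂ) ^ s * ∑ b ∈ T, rbU b * rbE s (T.erase b) := by
    calc ∑ b ∈ T, rbU b * ∏ k ∈ T.erase b, (rbD k - rbU k)
        = ∑ b ∈ T, ∑ s ∈ range T.card,
            rbU b * ((-1 : MvPolynomial (Fin 4) ℂ) ^ s * rbE s (T.erase b)) := by
          refine sum_congr rfl fun b hb => ?_
          rw [← stub_rbE1 (T.erase b), card_erase_add_one hb, mul_sum]
      _ = ∑ s ∈ range T.card,
            (-1 : MvPolynomial (Fin 4) ℂ) ^ s * ∑ b ∈ T, rbU b * rbE s (T.erase b) := by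
          rw [sum_comm]
          refine sum_congr rfl fun s _ => ?_
          rw [mul_sum]
          refine sum_congr rfl fun b _ => ?_
          ring
  rw [hR, sum_range_succ', Nat.cast_zero, zero_mul, mul_zero, add_zero]
  refine sum_congr rfl fun s _ => ?_
  rw [sum_rbU_mul_rbE_erase]
  ring

end

end Summit.ValiantsHypothesis.ValiantsHypothesis.Theorems.HeadFlip
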